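import Summits.QuantumFields.GaugeBoot.ClassBHaarShift
import Literature.Probability.LatticeModels.GibbsSpecificationSingleSite
import Literature.MathematicalPhysics.QuantumFieldTheory.StrongCouplingActivities
import HarnessLib

/-!
# Haar-shift states ARE the DLR states: the one-link Gibbs identity implies the DLR equations (gauge-boot, Class B)

HONEST FRAMING (cell `pub-gaugeboot`, page 1 of every file): the venture produces certified bounds
on lattice expectations at stated coupling, gauge group, dimension and torus size; NOT a mass gap,
NOT a continuum limit, NOT a string tension; NOT Yang–Mills-summit-bearing (barriers
`FixedCouplingUltralocality`, `PerturbativeInvisibility`). This module is a structural statement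
about the class of states a loop-equation SDP quantifies over; it certifies no number.

## Content

`ClassB.lean` axiomatises the states of the lattice bootstrap through the ONE-LINK HAAR-SHIFT
IDENTITY `IsHaarShiftState ρ β μ` — the measure form of the Schwinger–Dyson / loop equations —
and `ClassBHaarShift.lean` proved that every DLR state of the Wilson specification is such a state
(`isHaarShiftState_of_mem_ymGibbsMeasures`). This file proves the CONVERSE, so that the two
notions coincide:

* `IsHaarShiftState.integral_mul_exp_comp_update` — for a Haar-shift state the tilted measure
  `e^{β S_e} dμ` is invariant under every left shift `U_e ↦ g U_e` of the link `e` (tested on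
  continuous cylinder observables), hence as a measure (`IsHaarShiftState.map_update_mul_tilted`,
  continuous cylinder integrals determine probability measures on `G^{edges}`);
* `IsHaarShiftState.lintegral_lmarginal_tilted` — integrating the shift invariance over `g`
  against Haar measure (Tonelli, right invariance): `e^{β S_e} dμ` is invariant under the Haar
  AVERAGE of the link `e`, i.e. it is `(e^{β S_e} dμ)|_{𝓕_{eᶜ}} ⊗ Haar_e`;
* ★ `IsHaarShiftState.lintegral_ymSpecification_singleton` — undoing the tilt: `μ` satisfies the
  one-link DLR equation `μ γ_{e} = μ` for the lattice Yang–Mills specification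
  `γ = ymSpecification ρ β` (the conditional law of `U_e` given the other links is Haar measure
  tilted by `e^{-β S_e}`, Georgii 2011 Def. 2.9; Seiler LNP 159 Ch. 2);
* ★★ `mem_ymGibbsMeasures_of_isHaarShiftState` — by Georgii's Theorem 1.33 (one-site DLR
  equations characterise the Gibbs measures of a positive specification; tree
  `Literature.Probability.LatticeModels.isGibbsMeasure_tilted_of_singleton`) a Haar-shift
  probability state satisfies ALL DLR equations: `μ ∈ 𝒢(β)`;
* ★★ `isHaarShiftState_iff_mem_ymGibbsMeasures` — HENCE, for a probability measure on the gauge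
  configurations of `ℤ^d` (compact metrisable `G`, continuous `ρ`, any real `β`, any `d`):
  `IsHaarShiftState ρ β μ ↔ μ ∈ ymGibbsMeasures ρ β`. The `haarShift` field of `ClassBState` /
  `TiltedClassState` is exactly the DLR property; Class-B (Class-T) states are precisely the DLR
  states with the listed invariance and reflection-positivity properties
  (`ClassBState.mem_ymGibbsMeasures`).

Consequences drawn elsewhere (`HaarShiftUniqueness.lean`): at strong coupling
`6(d-1) N |β| < 1` there is exactly one Haar-shift probability state (Dobrushin), so the loop
equations alone determine the state there, and Class T is empty at small negative `β` in every
dimension `d ≥ 3`.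

References: H.-O. Georgii, *Gibbs Measures and Phase Transitions* (2011), Def. 1.23, Rem. 1.24,
Thm. 1.33, Def. 2.9; E. Seiler, LNP 159 (1982) Ch. 2 (one-link DLR equation of lattice gauge
theory); V. Kazakov, Z. Zheng, arXiv:2203.11360 §3 (loop equations as bootstrap axioms). The
equivalence "loop-equation states = DLR states" is folklore; no printed statement was found.
-/

noncomputable section

open MeasureTheory
open scoped ENNReal
open Literature.Probability.LatticeModels (glueWith IsGibbsMeasure isGibbsMeasure_tilted_of_singleton
  tilted_map_glueWith_pi_apply lmarginal_ofReal_exp_ne_zero lmarginal_ofReal_exp_ne_top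
  lmarginal_mul_of_dependsOn_right dependsOn_compl_lmarginal)
open Literature.MathematicalPhysics.QuantumLattice
open Literature.MathematicalPhysics.QuantumFieldTheory (haarProbability
  measure_eq_of_integral_cylinder_eq dependsOn_wilsonBoundaryAction_sub)

namespace Summit.QuantumFields.GaugeBoot

variable {d N : ℕ} {G : Type*} [Group G] [TopologicalSpace G] [IsTopologicalGroup G]
  [CompactSpace G] [MeasurableSpace G] [BorelSpace G] [SecondCountableTopology G]
variable (ρ : G →* Matrix (Fin N) (Fin N) ℂ)

/-! ## The tilted state `e^{β S_e} dμ` is invariant under the shifts of the link `e` -/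

section Shift

omit [TopologicalSpace G] [IsTopologicalGroup G] [CompactSpace G] [MeasurableSpace G] [BorelSpace G]
  [SecondCountableTopology G] in
/-- Shifting the link `e` by `g` and then by `g⁻¹` (in the shifted configuration) returns the
original configuration. -/
theorem update_mul_update_inv_mul (e : ZdEdge d) (g : G) (U : LGConfig d G) :
    Function.update (Function.update U e (g * U e)) e
        (g⁻¹ * Function.update U e (g * U e) e) = U := by
  rw [Function.update_self, inv_mul_cancel_left, Function.update_idem, Function.update_eq_self]

omit [TopologicalSpace G] [IsTopologicalGroup G] [CompactSpace G] [MeasurableSpace G] [BorelSpace G]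
  [SecondCountableTopology G] in
/-- The Boltzmann factor of the link `e`, read after a shift of `e`, is a cylinder observable on
`e` and the edges of the plaquettes through `e`. -/
theorem isCylinder_exp_action_comp_update (β : ℝ) (e : ZdEdge d) (g : G) :
    IsCylinder (fun U : LGConfig d G => Real.exp (β * wilsonBoundaryAction ρ {e}
        (Function.update U e (g * U e))))
      (insert e (((plaquettesTouching ({e} : Finset (ZdEdge d))).biUnion plaquetteEdges))) := by
  intro U V hUV
  have h : wilsonBoundaryAction ρ {e} (Function.update U e (g * U e)) =
      wilsonBoundaryAction ρ {e} (Function.update V e (g * V e)) := by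
    refine isCylinder_wilsonBoundaryAction_holds ρ {e} fun x hx => ?_
    by_cases hxe : x = e
    · subst hxe
      rw [Function.update_self, Function.update_self,
        hUV x (Finset.mem_coe.2 (Finset.mem_insert_self _ _))]
    · rw [Function.update_of_ne hxe, Function.update_of_ne hxe,
        hUV x (Finset.mem_coe.2 (Finset.mem_insert_of_mem hx))]
  show Real.exp _ = Real.exp _
  rw [h]

omit [CompactSpace G] [BorelSpace G] [SecondCountableTopology G] in
/-- **Shift invariance of the tilted state on observables**: for a Haar-shift state `μ`, every
link `e`, `g ∈ G` and every continuous cylinder observable `F`,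
`∫ F(U[e ↦ g U_e]) e^{β S_e(U)} dμ = ∫ F(U) e^{β S_e(U)} dμ` — the Haar-shift identity applied to
`F · (e^{β S_e} ∘ shift by g⁻¹)`. [folklore] -/
theorem IsHaarShiftState.integral_mul_exp_comp_update (hρ : Continuous ρ) {β : ℝ}
    {μ : Measure (LGConfig d G)} (hμ : IsHaarShiftState ρ β μ) (e : ZdEdge d) (g : G)
    {F : LGConfig d G → ℝ} {S : Finset (ZdEdge d)} (hFS : IsCylinder F S) (hFc : Continuous F) :
    ∫ U, F (Function.update U e (g * U e)) * Real.exp (β * wilsonBoundaryAction ρ {e} U) ∂μ =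
      ∫ U, F U * Real.exp (β * wilsonBoundaryAction ρ {e} U) ∂μ := by
  have hS : Continuous (wilsonBoundaryAction (G := G) ρ {e}) :=
    continuous_wilsonBoundaryAction ρ hρ _
  have key := hμ e g (fun U => F U * Real.exp (β * wilsonBoundaryAction ρ {e}
      (Function.update U e (g⁻¹ * U e))))
    (S ∪ insert e (((plaquettesTouching ({e} : Finset (ZdEdge d))).biUnion plaquetteEdges)))
    (Literature.MathematicalPhysics.QuantumFieldTheory.IsCylinder.mul hFS
      (isCylinder_exp_action_comp_update ρ β e g⁻¹))
    (hFc.mul (Real.continuous_exp.comp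
      (continuous_const.mul (hS.comp (continuous_update_mul e g⁻¹)))))
  have h1 : ∀ U : LGConfig d G, F (Function.update U e (g * U e)) * Real.exp (β *
      wilsonBoundaryAction ρ {e} (Function.update (Function.update U e (g * U e)) e
        (g⁻¹ * Function.update U e (g * U e) e))) =
      F (Function.update U e (g * U e)) * Real.exp (β * wilsonBoundaryAction ρ {e} U) :=
    fun U => by rw [update_mul_update_inv_mul]
  have h2 : ∀ U : LGConfig d G, F U * Real.exp (β * wilsonBoundaryAction ρ {e}
      (Function.update U e (g⁻¹ * U e))) * Real.exp (-(β * (wilsonBoundaryAction ρ {e}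
        (Function.update U e (g⁻¹ * U e)) - wilsonBoundaryAction ρ {e} U))) =
      F U * Real.exp (β * wilsonBoundaryAction ρ {e} U) := fun U => by
    rw [mul_assoc, ← Real.exp_add]
    congr 2
    ring
  simpa only [h1, h2] using key

variable [T2Space G]

omit [T2Space G] in
/-- The tilt `e^{β S_e} dμ / Z` of a probability measure is a probability measure. -/
theorem isProbabilityMeasure_tilted_action (hρ : Continuous ρ) (β : ℝ) (e : ZdEdge d)
    (μ : Measure (LGConfig d G)) [IsProbabilityMeasure μ] :
    IsProbabilityMeasure (μ.tilted fun U => β * wilsonBoundaryAction ρ {e} U) := by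
  have hw : Continuous fun U : LGConfig d G => Real.exp (β * wilsonBoundaryAction ρ {e} U) :=
    Real.continuous_exp.comp (continuous_const.mul (continuous_wilsonBoundaryAction ρ hρ _))
  obtain ⟨Cw, hCw⟩ := exists_bound_of_continuous hw
  exact isProbabilityMeasure_tilted (integrable_of_bound hw.aestronglyMeasurable hCw)

/-- **Shift invariance of the tilted state as a measure**: for a Haar-shift probability state
`μ`, the probability measure `ν_e = e^{β S_e} dμ / Z` is invariant under every left shift
`U ↦ U[e ↦ g U_e]` of the link `e` (continuous cylinder integrals determine probability measures
on `G^{edges(ℤ^d)}`, `measure_eq_of_integral_cylinder_eq`). [folklore] -/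
theorem IsHaarShiftState.map_update_mul_tilted (hρ : Continuous ρ) {β : ℝ}
    {μ : Measure (LGConfig d G)} [IsProbabilityMeasure μ] (hμ : IsHaarShiftState ρ β μ)
    (e : ZdEdge d) (g : G) :
    (μ.tilted fun U => β * wilsonBoundaryAction ρ {e} U).map
        (fun U => Function.update U e (g * U e)) =
      μ.tilted fun U => β * wilsonBoundaryAction ρ {e} U := by
  haveI := isProbabilityMeasure_tilted_action ρ hρ β e μ
  have hτ : Measurable fun U : LGConfig d G => Function.update U e (g * U e) :=
    measurable_update_mul e g
  haveI : IsProbabilityMeasure ((μ.tilted fun U => β * wilsonBoundaryAction ρ {e} U).map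
      fun U => Function.update U e (g * U e)) := Measure.isProbabilityMeasure_map hτ.aemeasurable
  refine measure_eq_of_integral_cylinder_eq fun F S hFS hFc _ => ?_
  rw [integral_map hτ.aemeasurable hFc.aestronglyMeasurable, integral_tilted, integral_tilted]
  simp only [smul_eq_mul]
  have hL : ∀ U : LGConfig d G, Real.exp (β * wilsonBoundaryAction ρ {e} U) /
      (∫ V, Real.exp (β * wilsonBoundaryAction ρ {e} V) ∂μ) * F (Function.update U e (g * U e)) =
      (∫ V, Real.exp (β * wilsonBoundaryAction ρ {e} V) ∂μ)⁻¹ *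
        (F (Function.update U e (g * U e)) * Real.exp (β * wilsonBoundaryAction ρ {e} U)) :=
    fun U => by rw [div_eq_mul_inv]; ring
  have hR : ∀ U : LGConfig d G, Real.exp (β * wilsonBoundaryAction ρ {e} U) /
      (∫ V, Real.exp (β * wilsonBoundaryAction ρ {e} V) ∂μ) * F U =
      (∫ V, Real.exp (β * wilsonBoundaryAction ρ {e} V) ∂μ)⁻¹ *
        (F U * Real.exp (β * wilsonBoundaryAction ρ {e} U)) := fun U => by
    rw [div_eq_mul_inv]; ring
  simp_rw [hL, hR]
  rw [integral_const_mul, integral_const_mul, hμ.integral_mul_exp_comp_update ρ hρ e g hFS hFc]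

omit [CompactSpace G] [T2Space G] in
/-- The map `(U, g) ↦ U[e ↦ g U_e]` is jointly measurable. -/
theorem measurable_update_mul_prod (e : ZdEdge d) :
    Measurable fun p : LGConfig d G × G => Function.update p.1 e (p.2 * p.1 e) := by
  have h1 : Measurable fun p : LGConfig d G × G => (p.1, p.2 * p.1 e) :=
    measurable_fst.prodMk (measurable_snd.mul ((measurable_pi_apply e).comp measurable_fst))
  exact measurable_update'.comp h1

/-- **The tilted state is invariant under the Haar average of the link `e`**: for a Haar-shift
probability state and every measurable `F ≥ 0`,
`∫ (∫ F(U[e ↦ h]) dh) dν_e(U) = ∫ F dν_e` with `ν_e = e^{β S_e} dμ / Z` — i.e. under `ν_e` the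
link variable `U_e` is Haar distributed independently of the other links (Tonelli over the shift
invariance `IsHaarShiftState.map_update_mul_tilted`, right invariance of Haar measure).
[folklore] -/
theorem IsHaarShiftState.lintegral_lmarginal_tilted (hρ : Continuous ρ) {β : ℝ}
    {μ : Measure (LGConfig d G)} [IsProbabilityMeasure μ] (hμ : IsHaarShiftState ρ β μ)
    (e : ZdEdge d) {F : LGConfig d G → ℝ≥0∞} (hF : Measurable F) :
    ∫⁻ U, lmarginal (fun _ : ZdEdge d => haarProbability G) {e} F U
        ∂(μ.tilted fun U => β * wilsonBoundaryAction ρ {e} U) =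
      ∫⁻ U, F U ∂(μ.tilted fun U => β * wilsonBoundaryAction ρ {e} U) := by
  haveI := isProbabilityMeasure_tilted_action ρ hρ β e μ
  have hinv : ∀ g : G, ∫⁻ U, F (Function.update U e (g * U e))
      ∂(μ.tilted fun U => β * wilsonBoundaryAction ρ {e} U) =
      ∫⁻ U, F U ∂(μ.tilted fun U => β * wilsonBoundaryAction ρ {e} U) := fun g => by
    have h := lintegral_map (μ := μ.tilted fun U => β * wilsonBoundaryAction ρ {e} U) hF
      (measurable_update_mul e g)
    rw [hμ.map_update_mul_tilted ρ hρ e g] at h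
    exact h.symm
  rw [lmarginal_singleton]
  have hri : ∀ U : LGConfig d G, ∫⁻ h, F (Function.update U e h) ∂haarProbability G =
      ∫⁻ g, F (Function.update U e (g * U e)) ∂haarProbability G := fun U =>
    (lintegral_mul_right_eq_self (fun h => F (Function.update U e h)) (U e)).symm
  simp_rw [hri]
  rw [lintegral_lintegral_swap (f := fun (U : LGConfig d G) (g : G) => F (Function.update U e (g * U e)))
    (by exact (hF.comp (measurable_update_mul_prod e)).aemeasurable)]
  simp_rw [hinv]
  rw [lintegral_const, measure_univ, mul_one]

end Shift

/-! ## The one-link DLR equation -/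

section OneLinkDLR

variable [T2Space G]

omit [T2Space G] in
/-- Undoing the tilt: for every `K ≥ 0`,
`∫ K dμ = ∫ (Z e^{-β S_e}) · K dν_e` with `ν_e = e^{β S_e} dμ / Z`, `Z = ∫ e^{β S_e} dμ`. -/
theorem lintegral_eq_lintegral_tilted_action (hρ : Continuous ρ) (β : ℝ) (e : ZdEdge d)
    (μ : Measure (LGConfig d G)) [IsProbabilityMeasure μ] (K : LGConfig d G → ℝ≥0∞) :
    ∫⁻ U, K U ∂μ = ∫⁻ U, ENNReal.ofReal ((∫ V, Real.exp (β * wilsonBoundaryAction ρ {e} V) ∂μ) *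
        Real.exp (-β * wilsonBoundaryAction ρ {e} U)) * K U
          ∂(μ.tilted fun U => β * wilsonBoundaryAction ρ {e} U) := by
  have hw : Continuous fun U : LGConfig d G => Real.exp (β * wilsonBoundaryAction ρ {e} U) :=
    Real.continuous_exp.comp (continuous_const.mul (continuous_wilsonBoundaryAction ρ hρ _))
  obtain ⟨Cw, hCw⟩ := exists_bound_of_continuous hw
  have hZ : 0 < ∫ V, Real.exp (β * wilsonBoundaryAction ρ {e} V) ∂μ :=
    integral_exp_pos (integrable_of_bound hw.aestronglyMeasurable hCw)
  rw [lintegral_tilted]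
  refine lintegral_congr fun U => ?_
  rw [← mul_assoc, ← ENNReal.ofReal_mul (div_nonneg (Real.exp_pos _).le hZ.le)]
  have h1 : Real.exp (β * wilsonBoundaryAction ρ {e} U) /
      (∫ V, Real.exp (β * wilsonBoundaryAction ρ {e} V) ∂μ) *
      ((∫ V, Real.exp (β * wilsonBoundaryAction ρ {e} V) ∂μ) *
        Real.exp (-β * wilsonBoundaryAction ρ {e} U)) = 1 := by
    rw [div_mul_eq_mul_div, mul_comm (Real.exp _) (_ * _), mul_assoc, ← Real.exp_add,
      show -β * wilsonBoundaryAction ρ {e} U + β * wilsonBoundaryAction ρ {e} U = 0 by ring,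
      Real.exp_zero, mul_one, div_self hZ.ne']
  rw [h1, ENNReal.ofReal_one, one_mul]

/-- ★ **A Haar-shift state satisfies the one-link DLR equation** `μ γ_{e} = μ` for the lattice
Yang–Mills specification `γ = ymSpecification ρ β` (Georgii 2011, Def. 2.9: the conditional law of
`U_e` given the other links is Haar measure tilted by `e^{-β S_e}`; Seiler LNP 159 Ch. 2): for every
link `e` and every measurable `A`, `∫ γ_{e}(A | η) dμ(η) = μ(A)`. Proof: write
`γ_{e}(A | η) = (∫ e^{-βS_e} 1_A dU_e)(η) / (∫ e^{-βS_e} dU_e)(η)`, pass to `ν_e = e^{βS_e} dμ / Z`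
(`lintegral_eq_lintegral_tilted_action`), use the Haar-average invariance of `ν_e` twice
(`IsHaarShiftState.lintegral_lmarginal_tilted`) and cancel the normaliser, which does not depend
on `U_e`. [folklore] -/
theorem IsHaarShiftState.lintegral_ymSpecification_singleton (hρ : Continuous ρ) {β : ℝ}
    {μ : Measure (LGConfig d G)} [IsProbabilityMeasure μ] (hμ : IsHaarShiftState ρ β μ)
    (e : ZdEdge d) {A : Set (LGConfig d G)} (hA : MeasurableSet A) :
    ∫⁻ η, ymSpecification ρ β {e} η A ∂μ = μ A := by
  -- the one-link Boltzmann factor `E = e^{-β S_e}` and its Haar marginal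
  have hφc : Continuous fun U : LGConfig d G => -β * wilsonBoundaryAction ρ {e} U :=
    continuous_const.mul (continuous_wilsonBoundaryAction ρ hρ _)
  have hφb : ∃ C, ∀ U : LGConfig d G, |-β * wilsonBoundaryAction ρ {e} U| ≤ C :=
    exists_bound_of_continuous hφc
  obtain ⟨E, hE⟩ : ∃ E : LGConfig d G → ℝ≥0∞,
      E = fun U => ENNReal.ofReal (Real.exp (-β * wilsonBoundaryAction ρ {e} U)) := ⟨_, rfl⟩
  have hEm : Measurable E := hE ▸ hφc.measurable.exp.ennreal_ofReal
  have hind : Measurable (A.indicator (1 : LGConfig d G → ℝ≥0∞)) := measurable_one.indicator hA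
  have hJ0 : ∀ η : LGConfig d G, lmarginal (fun _ : ZdEdge d => haarProbability G) {e} E η ≠ 0 :=
    fun η => by rw [hE]; exact lmarginal_ofReal_exp_ne_zero (haarProbability G) {e} η hφc.measurable hφb
  have hJt : ∀ η : LGConfig d G, lmarginal (fun _ : ZdEdge d => haarProbability G) {e} E η ≠ ∞ :=
    fun η => by rw [hE]; exact lmarginal_ofReal_exp_ne_top (haarProbability G) {e} η hφc.measurable hφb
  have hJm : Measurable (lmarginal (fun _ : ZdEdge d => haarProbability G) {e} E) := hEm.lmarginal _
  -- `γ_{e}(A | η)` as a ratio of one-link Haar marginals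
  have hker : ∀ η : LGConfig d G, ymSpecification ρ β {e} η A =
      lmarginal (fun _ : ZdEdge d => haarProbability G) {e} (fun σ => E σ * A.indicator 1 σ) η /
        lmarginal (fun _ : ZdEdge d => haarProbability G) {e} E η := fun η => by
    rw [hE]
    exact tilted_map_glueWith_pi_apply (haarProbability G) {e} η hφc.measurable hφb hA
  -- the ratio `R = J(E 1_A) / J E` does not depend on `U_e`
  obtain ⟨R, hR⟩ : ∃ R : LGConfig d G → ℝ≥0∞, R = fun η =>
      lmarginal (fun _ : ZdEdge d => haarProbability G) {e} (fun σ => E σ * A.indicator 1 σ) η /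
        lmarginal (fun _ : ZdEdge d => haarProbability G) {e} E η := ⟨_, rfl⟩
  have hRm : Measurable R := hR ▸ ((hEm.fun_mul hind).lmarginal _).div hJm
  have hRdep : DependsOn R ((↑({e} : Finset (ZdEdge d)) : Set (ZdEdge d))ᶜ) := by
    rw [hR]
    intro x y hxy
    show _ / _ = _ / _
    rw [dependsOn_compl_lmarginal (fun _ : ZdEdge d => haarProbability G) {e} _ hxy,
      dependsOn_compl_lmarginal (fun _ : ZdEdge d => haarProbability G) {e} E hxy]
  -- `J(E R) = J(E 1_A)` pointwise
  have hJR : ∀ η : LGConfig d G,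
      lmarginal (fun _ : ZdEdge d => haarProbability G) {e} (fun σ => E σ * R σ) η =
        lmarginal (fun _ : ZdEdge d => haarProbability G) {e} (fun σ => E σ * A.indicator 1 σ) η :=
    fun η => by
      rw [lmarginal_mul_of_dependsOn_right _ {e} hRdep hEm η, hR,
        ENNReal.mul_div_cancel (hJ0 η) (hJt η)]
  -- the density `D = Z e^{-β S_e} = Z · E` of `μ` with respect to `ν_e`
  have hD : ∀ U : LGConfig d G, ENNReal.ofReal ((∫ V, Real.exp (β * wilsonBoundaryAction ρ {e} V)
      ∂μ) * Real.exp (-β * wilsonBoundaryAction ρ {e} U)) =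
      ENNReal.ofReal (∫ V, Real.exp (β * wilsonBoundaryAction ρ {e} V) ∂μ) * E U := fun U => by
    rw [hE, ← ENNReal.ofReal_mul (integral_nonneg fun V => (Real.exp_pos _).le)]
  -- the chain
  have hEAm : Measurable fun σ => E σ * A.indicator 1 σ := hEm.fun_mul hind
  calc ∫⁻ η, ymSpecification ρ β {e} η A ∂μ
      = ∫⁻ η, R η ∂μ := lintegral_congr fun η => by rw [hker, hR]
    _ = ∫⁻ η, ENNReal.ofReal (∫ V, Real.exp (β * wilsonBoundaryAction ρ {e} V) ∂μ) *
          (E η * R η) ∂(μ.tilted fun U => β * wilsonBoundaryAction ρ {e} U) := by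
        rw [lintegral_eq_lintegral_tilted_action ρ hρ β e μ R]
        exact lintegral_congr fun η => by rw [hD, mul_assoc]
    _ = ENNReal.ofReal (∫ V, Real.exp (β * wilsonBoundaryAction ρ {e} V) ∂μ) *
          ∫⁻ η, E η * R η ∂(μ.tilted fun U => β * wilsonBoundaryAction ρ {e} U) :=
        lintegral_const_mul _ (hEm.fun_mul hRm)
    _ = ENNReal.ofReal (∫ V, Real.exp (β * wilsonBoundaryAction ρ {e} V) ∂μ) *
          ∫⁻ η, E η * A.indicator 1 η ∂(μ.tilted fun U => β * wilsonBoundaryAction ρ {e} U) := by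
        rw [← hμ.lintegral_lmarginal_tilted ρ hρ e (hEm.fun_mul hRm),
          ← hμ.lintegral_lmarginal_tilted ρ hρ e hEAm]
        exact congrArg _ (lintegral_congr fun η => hJR η)
    _ = ∫⁻ η, ENNReal.ofReal (∫ V, Real.exp (β * wilsonBoundaryAction ρ {e} V) ∂μ) *
          (E η * A.indicator 1 η) ∂(μ.tilted fun U => β * wilsonBoundaryAction ρ {e} U) :=
        (lintegral_const_mul _ hEAm).symm
    _ = ∫⁻ η, A.indicator 1 η ∂μ := by
        rw [lintegral_eq_lintegral_tilted_action ρ hρ β e μ (A.indicator 1)]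
        exact lintegral_congr fun η => by rw [hD, mul_assoc]
    _ = μ A := lintegral_indicator_one hA

/-! ## Haar-shift states are DLR states -/

/-- ★★ **A Haar-shift probability state is a DLR state of the lattice Yang–Mills specification**:
`IsHaarShiftState ρ β μ ⇒ μ ∈ 𝒢(β)` (compact metrisable `G`, continuous `ρ`, any real `β`).
The one-link DLR equations hold by `IsHaarShiftState.lintegral_ymSpecification_singleton`, and
for the Wilson specification — product Haar measure tilted by the everywhere-positive densities
`e^{-β S_Λ}` with `S_{Λ'} - S_Λ` insensitive to the links of `Λ ⊆ Λ'` — the one-link equations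
imply all DLR equations by Georgii's Theorem 1.33
(`Literature.Probability.LatticeModels.isGibbsMeasure_tilted_of_singleton`). Converse of
`isHaarShiftState_of_mem_ymGibbsMeasures`. [folklore] -/
theorem mem_ymGibbsMeasures_of_isHaarShiftState (hρ : Continuous ρ) {β : ℝ}
    {μ : Measure (LGConfig d G)} [IsProbabilityMeasure μ] (hμ : IsHaarShiftState ρ β μ) :
    μ ∈ ymGibbsMeasures ρ β := by
  have hφc : ∀ Λ : Finset (ZdEdge d),
      Continuous fun U : LGConfig d G => -β * wilsonBoundaryAction ρ Λ U := fun Λ =>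
    continuous_const.mul (continuous_wilsonBoundaryAction ρ hρ Λ)
  have hloc : ∀ ⦃Λ Λ' : Finset (ZdEdge d)⦄, Λ ⊆ Λ' →
      DependsOn (fun U : LGConfig d G =>
        -β * wilsonBoundaryAction ρ Λ' U - -β * wilsonBoundaryAction ρ Λ U)
        ((↑Λ : Set (ZdEdge d))ᶜ) := by
    intro Λ Λ' h U U' hUU'
    have := dependsOn_wilsonBoundaryAction_sub (G := G) ρ h hUU'
    show -β * wilsonBoundaryAction ρ Λ' U - -β * wilsonBoundaryAction ρ Λ U =
      -β * wilsonBoundaryAction ρ Λ' U' - -β * wilsonBoundaryAction ρ Λ U'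
    linear_combination (-β) * this
  exact isGibbsMeasure_tilted_of_singleton (V := ZdEdge d) (haarProbability G)
    (φ := fun Λ U => -β * wilsonBoundaryAction ρ Λ U)
    (fun Λ => (hφc Λ).measurable) (fun Λ => exists_bound_of_continuous (hφc Λ)) hloc
    (fun x A hA => hμ.lintegral_ymSpecification_singleton ρ hρ x hA)

/-- ★★ **Haar-shift states are exactly the DLR states.** For a probability measure `μ` on the gauge
configurations of `ℤ^d` (compact metrisable `G`, continuous `ρ`, every real `β`, every `d`):
`IsHaarShiftState ρ β μ ↔ μ ∈ ymGibbsMeasures ρ β` — the one-link Gibbs identity behind the loop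
equations of the lattice bootstrap is equivalent to the full set of DLR equations
(`mem_ymGibbsMeasures_of_isHaarShiftState`, `isHaarShiftState_of_mem_ymGibbsMeasures`).
[folklore] -/
theorem isHaarShiftState_iff_mem_ymGibbsMeasures (hρ : Continuous ρ) {β : ℝ}
    {μ : Measure (LGConfig d G)} [IsProbabilityMeasure μ] :
    IsHaarShiftState ρ β μ ↔ μ ∈ ymGibbsMeasures ρ β :=
  ⟨mem_ymGibbsMeasures_of_isHaarShiftState ρ hρ, isHaarShiftState_of_mem_ymGibbsMeasures ρ hρ⟩

/-- **Every Class-B state is a DLR state** of the Wilson specification at its coupling (its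
`haarShift` field is the DLR property by `mem_ymGibbsMeasures_of_isHaarShiftState`); in
particular every consequence of the DLR equations (e.g. the tree's Dobrushin uniqueness at strong
coupling) applies to the states a Class-B certificate quantifies over. [folklore] -/
theorem ClassBState.mem_ymGibbsMeasures (hρ : Continuous ρ) {β : ℝ} (ω : ClassBState d ρ β) :
    ω.μ ∈ ymGibbsMeasures ρ β := by
  haveI := ω.isProbabilityMeasure
  exact mem_ymGibbsMeasures_of_isHaarShiftState ρ hρ ω.haarShift

end OneLinkDLR

end Summit.QuantumFields.GaugeBoot
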